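import Mathlib
import HarnessLib

/-!
# Low autocorrelation binary sequences (LABS): the objective and kernel-certified optima for small `N`

Packebusch–Mertens, *Low autocorrelation binary sequences*, J. Phys. A 49 (2016) 165001
(arXiv:1512.02475), §1: a binary sequence `S = (s₁,…,s_N)`, `s_i = ±1`, has aperiodic autocorrelations
`C_k(S) = ∑_{i=1}^{N-k} s_i s_{i+k}` (`k = 0,…,N−1`), "energy" `E(S) = ∑_{k=1}^{N-1} C_k(S)²` (eq. (2)) and
merit factor `F(S) = N²/(2E(S))` (eq. (3)); the LABS problem is to minimise `E` over the `2^N` sequences of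
length `N` (one instance per `N`; optimal sequences are known for `N ≤ 66`, ibid. abstract and Tables 1–2).

This file is the typed OBJECTIVE used by the quantum-optimisation scaling claims adjudicated in the
`pub-qadeq` lane (Shaydulin et al., Sci. Adv. 10, eadm6761 (2024) = arXiv:2308.02342 "time-to-solution" to the
optimum of exactly this `E`), plus kernel-checked (`decide`, no `native_decide`) optimal values
`labsMin N` for `3 ≤ N ≤ 7` — `1, 2, 2, 7, 3` — agreeing with the published tables and with an
independent brute-force enumeration (cell rule: two implementations). Larger `N` are beyond `decide`
and are deliberately not asserted here.

Design: a sequence is `s : Fin N → Bool` (`true ↦ +1`, `false ↦ −1`), `spin s i : ℤ`; `autocorr s k`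
sums `spin s i * spin s j` over the pairs `(i, j)` with `j = i + k` (written as a filtered double sum
over `Fin N × Fin N` so that no index arithmetic on `Fin` is needed); `energy s = ∑_{k : Fin N, k ≠ 0} C_k²`;
`labsMin N` is the minimum of `energy` over all sequences (for `N = 0` the unique empty sequence has
energy `0`). No named facts.

## References
* [PackebuschMertens2016] T. Packebusch, S. Mertens, J. Phys. A 49 (2016) 165001, §1 eqs. (1)–(3),
  Tables 1–2 (optimal `E` / `F` for `N ≤ 66`).
-/

namespace Literature.Combinatorics.Optimization

namespace LABS

open Finset

variable {N : ℕ}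

/-- The `±1` value of a Boolean-coded spin: `true ↦ 1`, `false ↦ −1`. [cite: PackebuschMertens2016, §1] -/
def spin (s : Fin N → Bool) (i : Fin N) : ℤ := if s i then 1 else -1

/-- `spin s i ^ 2 = 1`. [folklore] -/
theorem spin_sq (s : Fin N → Bool) (i : Fin N) : spin s i ^ 2 = 1 := by
  unfold spin; split <;> norm_num

/-- Aperiodic autocorrelation `C_k(S) = ∑_{i + k = j} s_i s_j` (the sum over `i = 1..N−k` of
`s_i s_{i+k}`), written as a filtered sum over ordered pairs. [cite: PackebuschMertens2016, §1 eq. (1)] -/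
def autocorr (s : Fin N → Bool) (k : ℕ) : ℤ :=
  ∑ p ∈ (univ : Finset (Fin N × Fin N)) with p.1.val + k = p.2.val, spin s p.1 * spin s p.2

/-- The peak value `C_0(S) = N`. [cite: PackebuschMertens2016, §1] -/
theorem autocorr_zero (s : Fin N → Bool) : autocorr s 0 = N := by
  unfold autocorr
  have hfilter : ((univ : Finset (Fin N × Fin N)).filter fun p => p.1.val + 0 = p.2.val) =
      (univ : Finset (Fin N)).map ⟨fun i => (i, i), fun a b h => (Prod.mk.inj h).1⟩ := by
    ext ⟨i, j⟩
    simp only [add_zero, mem_filter, mem_univ, true_and, mem_map, Function.Embedding.coeFn_mk,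
      Prod.mk.injEq]
    constructor
    · intro h; exact ⟨i, rfl, Fin.ext h⟩
    · rintro ⟨a, rfl, rfl⟩; rfl
  rw [hfilter, sum_map]
  simp only [Function.Embedding.coeFn_mk]
  have : ∀ i : Fin N, spin s i * spin s i = 1 := fun i => by rw [← sq, spin_sq]
  simp [this]

/-- The LABS "energy" (sidelobe energy) `E(S) = ∑_{k=1}^{N-1} C_k(S)²`.
[cite: PackebuschMertens2016, §1 eq. (2)] -/
def energy (s : Fin N → Bool) : ℤ :=
  ∑ k ∈ (univ : Finset (Fin N)) with k.val ≠ 0, autocorr s k.val ^ 2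

/-- `E(S) ≥ 0`. [folklore] -/
theorem energy_nonneg (s : Fin N → Bool) : 0 ≤ energy s :=
  sum_nonneg fun _ _ => sq_nonneg _

/-- The merit factor `F(S) = N² / (2 E(S))` as a rational number (junk value `N²/0 = 0` when
`E(S) = 0`, which happens only for `N ≤ 1`... and never for `N ≥ 2`, not asserted here).
[cite: PackebuschMertens2016, §1 eq. (3)] -/
def meritFactor (s : Fin N → Bool) : ℚ := (N : ℚ) ^ 2 / (2 * (energy s : ℚ))

/-- The optimal (minimal) LABS energy over all `2^N` sequences of length `N`; the single instance of
size `N` of the LABS problem asks for a sequence attaining it. [cite: PackebuschMertens2016, §1] -/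
def labsMin (N : ℕ) : ℤ :=
  (univ : Finset (Fin N → Bool)).inf' ⟨fun _ => true, mem_univ _⟩ energy

/-- `labsMin N` is attained. [folklore] -/
theorem exists_energy_eq_labsMin (N : ℕ) : ∃ s : Fin N → Bool, energy s = labsMin N := by
  obtain ⟨s, -, hs⟩ := exists_mem_eq_inf' (s := (univ : Finset (Fin N → Bool)))
    ⟨fun _ => true, mem_univ _⟩ energy
  exact ⟨s, hs.symm⟩

/-- `labsMin N` is a lower bound for every sequence. [folklore] -/
theorem labsMin_le_energy (s : Fin N → Bool) : labsMin N ≤ energy s :=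
  inf'_le _ (mem_univ s)

/-- Characterisation used for the certified values: `labsMin N = E` iff some sequence has energy `E`
and none has less. [folklore] -/
theorem labsMin_eq_iff (N : ℕ) (E : ℤ) :
    labsMin N = E ↔ (∃ s : Fin N → Bool, energy s = E) ∧ ∀ s : Fin N → Bool, E ≤ energy s := by
  constructor
  · rintro rfl
    exact ⟨exists_energy_eq_labsMin N, fun s => labsMin_le_energy s⟩
  · rintro ⟨⟨s, hs⟩, h⟩
    apply le_antisymm
    · exact hs ▸ labsMin_le_energy s
    · obtain ⟨t, ht⟩ := exists_energy_eq_labsMin N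
      exact ht ▸ h t

/-! ### Kernel-certified optimal energies for `3 ≤ N ≤ 7`
(Packebusch–Mertens Table 1: `F₃ = 4.5, F₄ = 4, F₅ = 6.25, F₆ = 2.571, F₇ = 8.167`, i.e.
`E = 1, 2, 2, 7, 3`; independently re-enumerated in the lane.) -/

/-- `E_min(3) = 1` (e.g. `++−`). [cite: PackebuschMertens2016, Table 1] -/
theorem labsMin_three : labsMin 3 = 1 :=
  (labsMin_eq_iff 3 1).2 ⟨⟨![true, true, false], by decide⟩, by decide⟩

/-- `E_min(4) = 2` (e.g. `+++−`). [cite: PackebuschMertens2016, Table 1] -/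
theorem labsMin_four : labsMin 4 = 2 :=
  (labsMin_eq_iff 4 2).2 ⟨⟨![true, true, true, false], by decide⟩, by decide⟩

/-- `E_min(5) = 2` (Barker `+++−+`). [cite: PackebuschMertens2016, Table 1] -/
theorem labsMin_five : labsMin 5 = 2 :=
  (labsMin_eq_iff 5 2).2 ⟨⟨![true, true, true, false, true], by decide⟩, by decide⟩

/-- `E_min(6) = 7`. [cite: PackebuschMertens2016, Table 1] -/
theorem labsMin_six : labsMin 6 = 7 :=
  (labsMin_eq_iff 6 7).2 ⟨⟨![true, true, true, false, false, true], by decide⟩, by decide⟩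

set_option maxRecDepth 8192 in
/-- `E_min(7) = 3` (Barker `+++−−+−`). [cite: PackebuschMertens2016, Table 1] -/
theorem labsMin_seven : labsMin 7 = 3 :=
  (labsMin_eq_iff 7 3).2 ⟨⟨![true, true, true, false, false, true, false], by decide⟩, by decide⟩

end LABS

end Literature.Combinatorics.Optimization
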